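import Literature.AnabelianGeometry.EtaleTheta.FrobenioidThetaDivisorSupportR

/-!
# [EtTh] §5, Proposition 5.3 (iv)–(vi): divisor-support vocabulary for PERFECT `Φ(A_⊚)` — REPAIR `Q` (second repair of record)

Mochizuki, *The étale theta function …*, Publ. RIMS **45** (2009)
[cite: MochizukiEtTh2009, Prop 5.3 p.325–327 (PDF pp.99–101); Prop 5.1 p.323 (PDF p.97); Prop 3.2 (i) p.296 (PDF p.70); §1 p.240 (PDF p.14)].
Seat abc-iut-L6-d1 (gen 4), lineage author of the first repair `FrobenioidThetaDivisorSupportR.lean`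
(`DivisorSupportData'`, p421648) for abc-iut-L2-d4's merge row W3-L2-03 (file of record
`FrobenioidThetaDivisorSupport.lean`, p418923).  Append-only repair by NEW declarations in a NEW file; nothing landed
is edited.

WHY A SECOND REPAIR.  abc-iut-f-127's certificate `Discharge/Sec5Prop53PerfectVacuity.lean` (p434934/p436191):
`isEmpty_divisorSupportData'_of_isPerfect` — `DivisorSupportData' 𝔓` is UNINHABITED whenever `Φ(A_⊚)` is a perfect
monoid, and Prop. 5.1 p.323 (PDF p.97) asserts "whose divisor monoid `Φ(−)` is perfect".  The culprit is the single
field `factor_carrier` of the `ℤ`-reading ("the primary elements of `𝔭` are the positive INTEGER powers of the prime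
log-divisor `gen 𝔭`", i.e. `Φ(A_⊚)_𝔭 ≅ ℤ_{≥0}`), whereas at perfect `Φ(A_⊚)` every primary component is itself
perfect (`Primes.isPerfect_submonoid_of_isPerfect`, p436191): print, Prop. 3.2 (i) p.296 (PDF p.70), "`DIV₊(Z^log_∞)^pf`
may be naturally identified with a direct product of copies of `ℚ_{≥0}`, indexed by the cusps … and irreducible
components of the special fiber" — `Φ(A_⊚)_𝔭` is a `ℚ_{≥0}`-LINE, in which the prime log-divisor is a
DISTINGUISHED element (p.325 (PDF p.99): "determined by identifying the elements on each side that arise from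
[scheme-theoretic] prime log-divisors"), not a generator.

WHAT CHANGES relative to `DivisorSupportData'` (and nothing else).
* F2 `factor_carrier` becomes: `a` is a primary element of `𝔭` iff its `𝔭`-coordinate is POSITIVE (rational) and
  all other coordinates vanish (`Φ(A_⊚)_𝔭 = ℚ_{>0}·gen_𝔭 ∪ {0}` inside `∏_𝔭 ℚ_{≥0}`, Prop. 3.2 (i)); `gen 𝔭`
  stays the element of coordinate `1` (the prime log-divisor).
* TWO printed pinning clauses are ADDED, tying abc-iut-L2-t4's "natural isomorphisms between primary components"
  (`DivisorPrimeData.ncspIso` / `cspIso`, Prop. 5.3 (ii)/(iii)) to the prime log-divisors: they map `gen 𝔭 ↦ gen 𝔮`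
  (p.325: the isomorphism "determined by identifying the elements on each side that arise from [scheme-theoretic]
  prime log-divisors"; Rmk. 3.8.2).  In the `ℤ`-reading this was automatic (a `ℤ_{≥0}`-line has one generator); for
  `ℚ_{≥0}`-lines it is CONTENT (abc-iut-f-127's `_of_generators` shape, p437114).
* F3 `incidence` is NOT a field: it is a theorem of F2 + the intersection-theory binder
  (`FrobenioidThetaDivisorSupportIncidence.lean`, p438836, ported to `Q` in this lineage's proof files).
* F1 `principal`, F5 `ordGp_divTheta_cusp`, F6 `exists_translate`, `le_ord_iff` verbatim as in the repair of record.
THE BINDER for perfect data.  At `ℚ`-divisors "principal ⇔ all degrees vanish" is wrong (`½·div(f)` has all degrees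
`0`); the structural hypothesis of GAP-LEDGER G-L2d4-2 is restated as `PrincipalIffIntegralDegreeZero`: "an element of
`Φ(A_⊚)^gp` is principal iff it is INTEGRAL (every coordinate relative to the prime log-divisors lies in `ℤ`) and its
degree on every irreducible component vanishes" — [EtTh] §1 p.240 (PDF p.14) "these degrees determine an isomorphism
`Pic(𝔜_N) ⥲ ℤ^ℤ`" is a statement about (integral) line bundles.  It is a predicate on the data, asserted nowhere.
THE CRITERIA.  `CspToNcspCriterionQ` / `CspToNcspWitnessedQ` verbatim as before; `AdjacencyCriterionQ` reads print's
"if `a ∈ 𝔭`, `b ∈ 𝔮` correspond via the natural isomorphisms of (ii)" for `a = m·gen 𝔭` of INTEGRAL multiplicity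
`m ≥ 1` (for a primary `a` of non-integral multiplicity no element at all is linearly equivalent to `a + b` under the
binder, so that the printed "every cuspidally minimal `c` … has support of cardinality 4 (respectively, 5 or 6)" would
hold vacuously on BOTH sides — the sentence is about elements arising from scheme-theoretic divisors).
HONEST FRAMING: data, definitions and predicates; no field asserts a result about an actual curve (instances are to be
CONSTRUCTED from the model); typed ≠ proved; no side taken on anything downstream; nothing here lies inside the
[IUTchIII] Cor. 3.12 cone. -/

namespace Literature.AnabelianGeometry.EtaleTheta

open CategoryTheory
open Literature.AlgebraicGeometry.Frobenioids

universe w v v' u u'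

namespace FrobenioidThetaDivisors

variable {C : Type u} [Category.{v} C] {D : Type u'} [Category.{v'} D] {𝔉 : ThetaFrobenioid.{w} C D}

/-- **The divisor-support vocabulary of the proof of Proposition 5.3 for PERFECT `Φ(A_⊚)`** (repair `Q` of
`DivisorSupportData'`, pp.326–327 (PDF pp.100–101); Prop. 5.1 p.323 (PDF p.97) "`Φ(−)` is perfect").  F2: the injective
PRODUCT-valued factorization homomorphism `Φ(A_⊚) ↪ ∏_𝔭 Φ(A_⊚)^pf_𝔭`, each line `Φ(A_⊚)_𝔭 ≅ ℚ_{≥0}` (Prop. 3.2 (i)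
p.296 (PDF p.70)) coordinatised by the prime log-divisor `gen 𝔭` of coordinate `1`, primary elements = elements of
positive coordinate supported at one prime; the natural isomorphisms between primary components of (ii)/(iii) pinned by
`gen 𝔭 ↦ gen 𝔮` (p.325 (PDF p.99)); F1 `principal`, F5 `ordGp_divTheta_cusp`, F6 `exists_translate` as in the repair of
record.  [cite: MochizukiEtTh2009, Prop 5.3 p.325–327 (PDF pp.99–101); Prop 5.1 p.323 (PDF p.97); Prop 3.2 (i) p.296 (PDF p.70); Rmk 3.8.2; Prop 1.4 (i) p.247 (PDF p.21); §1 p.238–240 (PDF pp.12–14)] -/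
structure DivisorSupportDataQ (𝔓 : DivisorPrimeData 𝔉) where
  /-- F2: the factorization homomorphism `Φ(A_⊚) → ∏_𝔭 Φ(A_⊚)^pf_𝔭`, `Φ(A_⊚)^pf_𝔭 ≅ ℚ_{≥0}·gen_𝔭`
  ([FrdI] Def. 2.4 (i)(c); [EtTh] Prop. 3.2 (i): a direct PRODUCT of copies of `ℚ_{≥0}`). -/
  factor : 𝔉.PhiAcirc →* (Primes 𝔉.PhiAcirc → Multiplicative ℚ)
  /-- the factorization homomorphism is injective ([FrdI] Def. 2.4 (i)(c): `Φ` perf-factorial). -/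
  factor_injective : Function.Injective factor
  /-- its coordinates are non-negative (`Φ(A_⊚)^pf_𝔭 ≅ ℚ_{≥0}`). -/
  factor_nonneg : ∀ (a : 𝔉.PhiAcirc) (𝔭 : Primes 𝔉.PhiAcirc), 0 ≤ Multiplicative.toAdd (factor a 𝔭)
  /-- the prime log-divisor of `𝔭` (p.325 (PDF p.99): the element of `Φ(A_⊚)_𝔭` "that arise[s] from [the
  scheme-theoretic] prime log-divisor"), a DISTINGUISHED element of the `ℚ_{≥0}`-line `Φ(A_⊚)_𝔭`. -/
  gen : Primes 𝔉.PhiAcirc → 𝔉.PhiAcirc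
  /-- `gen 𝔭` has coordinate `1` at `𝔭` … -/
  factor_gen_self : ∀ 𝔭 : Primes 𝔉.PhiAcirc, factor (gen 𝔭) 𝔭 = Multiplicative.ofAdd 1
  /-- … and `0` elsewhere. -/
  factor_gen_of_ne : ∀ {𝔭 𝔮 : Primes 𝔉.PhiAcirc}, 𝔮 ≠ 𝔭 → factor (gen 𝔭) 𝔮 = 1
  /-- F2 (REPAIR `Q`): the primary elements of `𝔭` are exactly the elements of POSITIVE (rational) `𝔭`-coordinate
  whose other coordinates vanish — `Φ(A_⊚)_𝔭` is a `ℚ_{≥0}`-line (Prop. 3.2 (i) p.296 (PDF p.70): "a direct product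
  of copies of `ℚ_{≥0}`, indexed by the cusps … and irreducible components"; Prop. 5.1: `Φ(−)` perfect). -/
  factor_carrier : ∀ (𝔭 : Primes 𝔉.PhiAcirc) (a : 𝔉.PhiAcirc),
    a ∈ 𝔭.carrier ↔ 0 < Multiplicative.toAdd (factor a 𝔭) ∧ ∀ 𝔮 : Primes 𝔉.PhiAcirc, 𝔮 ≠ 𝔭 → factor a 𝔮 = 1
  /-- the `𝔭`-coordinate IS the supremum of [FrdI] Def. 2.4 (i)(c): `(n/m)·gen_𝔭 ≤ a` in `Φ(A_⊚)^pf` iff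
  `gen_𝔭^n ∣ a^m` in `Φ(A_⊚)` (verbatim as in the repair of record).  [FrdI] Def. 2.4 (i)(c), kurims p.47. -/
  le_ord_iff : ∀ (𝔭 : Primes 𝔉.PhiAcirc) (a : 𝔉.PhiAcirc) (n m : ℕ), 0 < m →
    ((n : ℚ) ≤ m * Multiplicative.toAdd (factor a 𝔭) ↔ gen 𝔭 ^ n ∣ a ^ m)
  /-- PIN of Prop. 5.3 (ii) (p.325 (PDF p.99), Rmk. 3.8.2): the natural isomorphism `Φ(A_⊚)_𝔭 ⥲ Φ(A_⊚)_𝔮` between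
  non-cuspidal primary components maps the prime log-divisor to the prime log-divisor. -/
  ncspIso_gen : ∀ (𝔭 𝔮 : Primes 𝔉.PhiAcirc) (h𝔭 : ¬ 𝔓.IsCuspidal 𝔭) (h𝔮 : ¬ 𝔓.IsCuspidal 𝔮) (x : 𝔭.submonoid),
    (x : 𝔉.PhiAcirc) = gen 𝔭 → (𝔓.ncspIso 𝔭 𝔮 h𝔭 h𝔮 x : 𝔉.PhiAcirc) = gen 𝔮
  /-- PIN of Prop. 5.3 (iii) (p.325 (PDF p.99)): the natural isomorphism `Φ(A_⊚)_𝔭 ⥲ Φ(A_⊚)_𝔮` between cuspidal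
  primary components is "determined by identifying the elements on each side that arise from [scheme-theoretic]
  prime log-divisors". -/
  cspIso_gen : ∀ (𝔭 𝔮 : Primes 𝔉.PhiAcirc) (h𝔭 : 𝔓.IsCuspidal 𝔭) (h𝔮 : 𝔓.IsCuspidal 𝔮) (x : 𝔭.submonoid),
    (x : 𝔉.PhiAcirc) = gen 𝔭 → (𝔓.cspIso 𝔭 𝔮 h𝔭 h𝔮 x : 𝔉.PhiAcirc) = gen 𝔮
  /-- F1: "the image of the birational function monoid of the Frobenioid `C`" in `Φ(A_⊚)^gp` (p.326 (PDF p.100)). -/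
  principal : Subgroup (Algebra.GrothendieckGroup 𝔉.PhiAcirc)
  /-- F5 (Prop. 1.4 (i), p.247 (PDF p.21), read on `div(Θ̈)` of Prop. 5.3 (vi)): `div(Θ̈)` has order exactly
  `1` at every cuspidal prime. -/
  ordGp_divTheta_cusp : ∀ 𝔠 : Primes 𝔉.PhiAcirc, 𝔓.IsCuspidal 𝔠 →
    ordGpOf' factor 𝔠 𝔓.divTheta = Multiplicative.ofAdd 1
  /-- F6: every translation `t ∈ ℤ` of the chain of components is realised by some `g ∈ Aut_C(A_⊚)`
  (§1 p.238–239 (PDF pp.12–13); Prop. 5.3 (vi) p.326 (PDF p.100)), verbatim as in the file of record. -/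
  exists_translate : ∀ t : ℤ, ∃ g : Aut 𝔉.Acirc,
    (∀ 𝔭, 𝔓.IsCuspidal (Primes.congr (𝔉.pullAut g) 𝔭) ↔ 𝔓.IsCuspidal 𝔭) ∧
    ∀ (𝔭 : Primes 𝔉.PhiAcirc) (h𝔭 : ¬ 𝔓.IsCuspidal 𝔭) (h𝔭' : ¬ 𝔓.IsCuspidal (Primes.congr (𝔉.pullAut g) 𝔭)),
      𝔓.ncspEquivZ ⟨Primes.congr (𝔉.pullAut g) 𝔭, h𝔭'⟩ = 𝔓.ncspEquivZ ⟨𝔭, h𝔭⟩ + t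

namespace DivisorSupportDataQ

variable {𝔓 : DivisorPrimeData 𝔉}

/-- the order at `𝔭` on `Φ(A_⊚)^gp`. [cite: MochizukiEtTh2009, Prop 5.3 proof p.326 (PDF p.100)] -/
noncomputable def ordGp (𝔖 : DivisorSupportDataQ 𝔓) (𝔭 : Primes 𝔉.PhiAcirc) :
    Algebra.GrothendieckGroup 𝔉.PhiAcirc →* Multiplicative ℚ :=
  ordGpOf' 𝔖.factor 𝔭

/-- the (additive, `ℚ`-valued) order at `𝔭` of `x ∈ Φ(A_⊚)^gp`, i.e. its `gen 𝔭`-coordinate.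
[cite: MochizukiEtTh2009, Prop 5.3 proof p.326 (PDF p.100)] -/
noncomputable def ord (𝔖 : DivisorSupportDataQ 𝔓) (𝔭 : Primes 𝔉.PhiAcirc) (x : Algebra.GrothendieckGroup 𝔉.PhiAcirc) : ℚ :=
  Multiplicative.toAdd (𝔖.ordGp 𝔭 x)

/-- the support of an element of `Φ(A_⊚)^gp`. [cite: MochizukiEtTh2009, Prop 5.3 proof p.326 (PDF p.100)] -/
def supp (𝔖 : DivisorSupportDataQ 𝔓) (x : Algebra.GrothendieckGroup 𝔉.PhiAcirc) : Set (Primes 𝔉.PhiAcirc) :=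
  suppOf' 𝔖.factor x

/-- linear equivalence in `Φ(A_⊚)^gp`. [cite: MochizukiEtTh2009, Prop 5.3 proof p.326 (PDF p.100)] -/
def LinEquiv (𝔖 : DivisorSupportDataQ 𝔓) (x y : Algebra.GrothendieckGroup 𝔉.PhiAcirc) : Prop := LinEquivOf 𝔖.principal x y

/-- principal elements of `Φ(A_⊚)^gp`. [cite: MochizukiEtTh2009, Prop 5.3 proof p.326 (PDF p.100)] -/
def IsPrincipal (𝔖 : DivisorSupportDataQ 𝔓) (x : Algebra.GrothendieckGroup 𝔉.PhiAcirc) : Prop := IsPrincipalOf 𝔖.principal x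

/-- cuspidal elements of `Φ(A_⊚)^gp`. [cite: MochizukiEtTh2009, Prop 5.3 proof p.326 (PDF p.100)] -/
def IsCuspidalGp (𝔖 : DivisorSupportDataQ 𝔓) (x : Algebra.GrothendieckGroup 𝔉.PhiAcirc) : Prop :=
  IsCuspidalGpOf' 𝔓 𝔖.factor x

/-- cuspidally minimal elements of `Φ(A_⊚)^gp`. [cite: MochizukiEtTh2009, Prop 5.3 proof p.326 (PDF p.100)] -/
def IsCuspidallyMinimal (𝔖 : DivisorSupportDataQ 𝔓) (x : Algebra.GrothendieckGroup 𝔉.PhiAcirc) : Prop :=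
  IsCuspidallyMinimalOf' 𝔓 𝔖.factor 𝔖.principal x

/-- **The degree on an irreducible component** (as in the repair of record): for `x ∈ Φ(A_⊚)^gp` and a non-cuspidal
prime `𝔫`, `ord_{𝔫⁻} x − 2·ord_𝔫 x + ord_{𝔫⁺} x + Σ_{𝔠 cuspidal, 𝔠 ↦ 𝔫} ord_𝔠 x` in the prime-log-divisor
coordinates ([EtTh] §1 p.240 (PDF p.14)).  [cite: MochizukiEtTh2009, §1 p.240 (PDF p.14); Prop 5.3 proof p.326 (PDF p.100)] -/
noncomputable def degOn (𝔖 : DivisorSupportDataQ 𝔓) (𝔫 : {p : Primes 𝔉.PhiAcirc // ¬ 𝔓.IsCuspidal p})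
    (x : Algebra.GrothendieckGroup 𝔉.PhiAcirc) : ℚ :=
  𝔖.ord (ncspShift 𝔓 (-1) 𝔫).1 x - 2 * 𝔖.ord 𝔫.1 x + 𝔖.ord (ncspShift 𝔓 1 𝔫).1 x +
    ∑ᶠ 𝔠 ∈ {𝔠 : {p : Primes 𝔉.PhiAcirc // 𝔓.IsCuspidal p} | 𝔓.cspToNcsp 𝔠 = 𝔫}, 𝔖.ord 𝔠.1 x

/-- **Integral elements of `Φ(A_⊚)^gp`**: every coordinate relative to the prime log-divisors is an integer (the
lattice of divisors "arising from scheme-theoretic divisors" inside the `ℚ`-divisors `Φ(A_⊚)^gp = (∏ ℚ_{≥0})^gp`,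
Prop. 3.2 (i) p.296 (PDF p.70); principal divisors lie in it).  [cite: MochizukiEtTh2009, Prop 3.2 (i) p.296 (PDF p.70); §1 p.240 (PDF p.14)] -/
def Integral (𝔖 : DivisorSupportDataQ 𝔓) (x : Algebra.GrothendieckGroup 𝔉.PhiAcirc) : Prop :=
  ∀ 𝔭 : Primes 𝔉.PhiAcirc, ∃ z : ℤ, 𝔖.ord 𝔭 x = z

/-- **HYPOTHESIS BINDER `hInt` for perfect `Φ(A_⊚)`** (a predicate on the data, asserted nowhere; to be PROVED for the
genuine special fibre of `Ÿ`): "an element of `Φ(A_⊚)^gp` is principal if and only if it is integral and its degree on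
every irreducible component of the chain vanishes" — [EtTh] §1 p.240 (PDF p.14) "these degrees determine an
isomorphism `Pic(𝔜_N) ⥲ ℤ^ℤ`" (`Ÿ = Y_2`, p.243 (PDF p.17)), the "well-known intersection theory of divisors supported
on the chain of copies of the projective line" of p.326 (PDF p.100), for the lattice of integral divisors.
[cite: MochizukiEtTh2009, §1 p.240 (PDF p.14); Prop 5.3 proof p.326 (PDF p.100)] -/
def PrincipalIffIntegralDegreeZero (𝔖 : DivisorSupportDataQ 𝔓) : Prop :=
  ∀ x : Algebra.GrothendieckGroup 𝔉.PhiAcirc, 𝔖.IsPrincipal x ↔ 𝔖.Integral x ∧ ∀ 𝔫, 𝔖.degOn 𝔫 x = 0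

end DivisorSupportDataQ

/-! ### The verbatim criteria of the printed proof, over the perfect-`Φ` data -/

variable {𝔓 : DivisorPrimeData 𝔉}

/-- **The p.326 description of the surjection of (iv)** over the repaired data `Q` (shape as in the repair of record):
whenever `a ∈ 𝔞` is primary cuspidal and, for some cuspidal `b` coprime to `a`, `b − a` is cuspidally minimal and
linearly equivalent to a primary non-cuspidal `n ∈ 𝔫`, one has `cspToNcsp(𝔞) = 𝔫`.
[cite: MochizukiEtTh2009, Prop 5.3 proof p.326 (PDF p.100)] -/
def CspToNcspCriterionQ (𝔖 : DivisorSupportDataQ 𝔓) : Prop :=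
  ∀ (𝔞 𝔫 : Primes 𝔉.PhiAcirc) (h𝔞 : 𝔓.IsCuspidal 𝔞) (h𝔫 : ¬ 𝔓.IsCuspidal 𝔫) (a b n : 𝔉.PhiAcirc),
    a ∈ 𝔞.carrier → n ∈ 𝔫.carrier →
    𝔖.IsCuspidalGp (Algebra.GrothendieckGroup.of b) →
    CoprimeOf' 𝔖.factor (Algebra.GrothendieckGroup.of a) (Algebra.GrothendieckGroup.of b) →
    𝔖.IsCuspidallyMinimal (Algebra.GrothendieckGroup.of b * (Algebra.GrothendieckGroup.of a)⁻¹) →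
    𝔖.LinEquiv (Algebra.GrothendieckGroup.of b * (Algebra.GrothendieckGroup.of a)⁻¹)
      (Algebra.GrothendieckGroup.of n) →
    𝔓.cspToNcsp ⟨𝔞, h𝔞⟩ = ⟨𝔫, h𝔫⟩

/-- The situation of (iv) occurs at every cusp (shape as in the repair of record).
[cite: MochizukiEtTh2009, Prop 5.3 proof p.326 (PDF p.100)] -/
def CspToNcspWitnessedQ (𝔖 : DivisorSupportDataQ 𝔓) : Prop :=
  ∀ (𝔞 : Primes 𝔉.PhiAcirc), 𝔓.IsCuspidal 𝔞 → ∃ (𝔫 : Primes 𝔉.PhiAcirc) (_ : ¬ 𝔓.IsCuspidal 𝔫)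
    (a b n : 𝔉.PhiAcirc), a ∈ 𝔞.carrier ∧ n ∈ 𝔫.carrier ∧
      𝔖.IsCuspidalGp (Algebra.GrothendieckGroup.of b) ∧
      CoprimeOf' 𝔖.factor (Algebra.GrothendieckGroup.of a) (Algebra.GrothendieckGroup.of b) ∧
      𝔖.IsCuspidallyMinimal (Algebra.GrothendieckGroup.of b * (Algebra.GrothendieckGroup.of a)⁻¹) ∧
      𝔖.LinEquiv (Algebra.GrothendieckGroup.of b * (Algebra.GrothendieckGroup.of a)⁻¹)
        (Algebra.GrothendieckGroup.of n)

/-- **The pp.326–327 adjacency criterion of (v)** over the repaired data `Q`: "if `a ∈ 𝔭`, `b ∈ 𝔮` correspond via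
the natural isomorphisms of (ii), then `𝔭, 𝔮` are adjacent (respectively, not adjacent) if and only if every
cuspidally minimal `c ∈ Φ(A_⊚)^gp` which is linearly equivalent to `a + b` has support of cardinality `4`
(respectively, `5` or `6`)" — read for `a = m·gen 𝔭` of INTEGRAL multiplicity `m ≥ 1` (an element arising from a
scheme-theoretic divisor; for non-integral multiplicity nothing is linearly equivalent to `a + b` and both clauses
would be vacuous).  [cite: MochizukiEtTh2009, Prop 5.3 proof p.326–327 (PDF pp.100–101)] -/
def AdjacencyCriterionQ (𝔖 : DivisorSupportDataQ 𝔓) : Prop :=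
  ∀ (𝔭 𝔮 : Primes 𝔉.PhiAcirc) (h𝔭 : ¬ 𝔓.IsCuspidal 𝔭) (h𝔮 : ¬ 𝔓.IsCuspidal 𝔮), 𝔭 ≠ 𝔮 →
    ∀ (m : ℕ), 0 < m → ∀ a : 𝔭.submonoid, (a : 𝔉.PhiAcirc) = 𝔖.gen 𝔭 ^ m →
    let b : 𝔉.PhiAcirc := 𝔓.ncspIso 𝔭 𝔮 h𝔭 h𝔮 a
    (Adjacent 𝔓 ⟨𝔭, h𝔭⟩ ⟨𝔮, h𝔮⟩ ↔
      ∀ c, 𝔖.IsCuspidallyMinimal c →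
        𝔖.LinEquiv c (Algebra.GrothendieckGroup.of (a : 𝔉.PhiAcirc) * Algebra.GrothendieckGroup.of b) →
          (𝔖.supp c).ncard = 4) ∧
    (¬ Adjacent 𝔓 ⟨𝔭, h𝔭⟩ ⟨𝔮, h𝔮⟩ ↔
      ∀ c, 𝔖.IsCuspidallyMinimal c →
        𝔖.LinEquiv c (Algebra.GrothendieckGroup.of (a : 𝔉.PhiAcirc) * Algebra.GrothendieckGroup.of b) →
          (𝔖.supp c).ncard = 5 ∨ (𝔖.supp c).ncard = 6)

end FrobenioidThetaDivisors

end Literature.AnabelianGeometry.EtaleTheta
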